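import Literature.NumberTheory.EllipticCurves.BinaryQuarticForms
import Mathlib.Algebra.CubicDiscriminant
import HarnessLib

/-!
# Bhargava–Shankar, Theorem 3.7 (= Thm 2.14 of the published version): binary quartic forms as
# pairs of ternary quadratic forms, `SO(A₁, ℤ) = ρ(PGL₂(ℤ))`, and the resolvent cubic form

Topic `Literature/NumberTheory/EllipticCurves`; companion of `BinaryQuarticForms.lean` (the space
`V_R = BinaryQuartic R`, the substitution action `(f.subst γ)(v) = f(vγ)`, `GL2ZEquiv`).

Source: M. Bhargava, A. Shankar, *Binary quartic forms having bounded invariants, and the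
boundedness of the average rank of elliptic curves*, Ann. of Math. (2) 181 (2015) 191–242;
§3.3 of the held arXiv text `arXiv:1006.1002v2` (pp. 15–16) = §2.6 of the published version
("Uniformity estimates", eqs. (26)–(28), Theorem 2.14, Proposition 2.16). The space `V_ℤ` of
integral binary quartic forms embeds into the space `W_ℤ` of pairs of integral ternary quadratic
forms by

  `φ : ax⁴ + bx³y + cx²y² + dxy³ + ey⁴ ↦ (A₁, B_f)`,
  `A₁ = !![0, 0, ½; 0, −1, 0; ½, 0, 0]`, `B_f = !![a, b/2, 0; b/2, c, d/2; 0, d/2, e]`;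

`W_{ℤ,1}` is the set of pairs `(A₁, B)`, preserved by `F_{ℤ,1} × SO(A₁)`, `F_{ℤ,1}` the lower
unitriangular `(1 0; u 1)` acting by `(A, B) ↦ (A, B + uA)`; the representation of `PGL₂` on
binary quadratic forms gives `ρ : PGL₂(R) → SO(A₁, R)`, "the image of `PGL₂(R)` is equal to
`SO(A₁, R)`; the proof parallels that of Lemma 4.4.2 in [MWt]" (M. M. Wood, *Moduli spaces for
rings and ideals*, Ph.D. thesis, Princeton, 2009), `φ(γ · f) ≡ ρ(γ) · φ(f)` modulo `F_{ℤ,1}`, and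

> **Theorem 3.7** (Thm 2.14 of the published version). *The map `φ` gives a canonical bijection
> between `PGL₂(ℤ)`-orbits on `V_ℤ` and `F_{ℤ,1} × SO(A₁, ℤ)`-orbits on `W_{ℤ,1}`.*

This is the input of Prop. 2.16 of the published version ("an element of
`(GL₂(ℤ) × SL₃(ℤ))\W_ℤ` with nonzero discriminant has at most `12` preimages in `PGL₂(ℤ)\V_ℤ`",
via Delone and Evertse) and thereby of the uniformity estimate Thm 2.13 and the sieve to locally
soluble / Selmer classes (eq. (31) of the held text,
`Literature.NumberTheory.EllipticCurves.bhargavaShankar_sum_irredClassCount_asymptotic`).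
Everything in this file is **proved**; there are no named facts.

## Contents

* `TernaryPairs.twoA1 = 2A₁`, `BinaryQuartic.gram f = 2B_f` — Gram matrices are *doubled* so as
  to be integral: `W_{ℤ,1}` becomes the symmetric integer matrices with even diagonal
  (`TernaryPairs.IsEvenSymm`, `BinaryQuartic.W1`); `ver(x,y) (2B_f) ver(x,y)ᵀ = 2f(x,y)` on the
  Veronese vector `ver(x,y) = (x², xy, y²)` (`veronese_gram`).
* `TernaryPairs.symSq γ = R(γ)`, the symmetric square (`ver(vγ) = ver(v) R(γ)`), with
  `R(γγ') = R(γ)R(γ')`, `det R(γ) = (det γ)³`, `R(γ) (2A₁) R(γ)ᵀ = (det γ)² (2A₁)`; for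
  `γ ∈ M₂(ℤ)`, `TernaryPairs.rho γ = (det γ) R(γ)`, which for `γ ∈ GL₂(ℤ)` is Bhargava–Shankar's
  `ρ(γ) = (det γ)⁻¹(…)` (their displayed matrix for `(a b; c d)` is `R((d c; b a))`, the same map
  in the reversed coordinates `(p, q, r) ↔ (r, q, p)`: `symSq_reverse`), and `ρ(γ) ∈ SO(A₁, ℤ)`
  (`rho_mem_soA1`; `TernaryPairs.soA1 = {σ : det σ = 1, σ (2A₁) σᵀ = 2A₁}`, row-vector convention).
* **Equivariance** `gram_subst`: `2B_{γ·f} = R(γ) (2B_f) R(γ)ᵀ + u (2A₁)` with the explicit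
  `u = gramShift f γ`, over any commutative ring.
* **`SO(A₁, ℤ) = ρ(PGL₂(ℤ))`** (`exists_rho_eq_of_mem_soA1`, `soA1_eq_image_rho`), proved from the
  description `± (s², st, t²)` of the primitive integral isotropic vectors of `pr − q²`
  (`exists_eq_veronese_of_isotropic`) and a stabiliser computation (`eq_one_of_mem_soA1`).
* **Theorem 3.7 / 2.14**: `W1Equiv (gram f) (gram f') ↔ GL2ZEquiv f f'` (`w1Equiv_gram_iff`:
  equivariance one way, `SO(A₁, ℤ) = ρ(PGL₂(ℤ))` plus the unique normal form `gram_add_smul_inj`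
  the other), every element of `W_{ℤ,1}` is `F_{ℤ,1}`-equivalent to some `φ(f)`
  (`exists_eq_gram_add_smul`), packaged as the bijection
  `BinaryQuartic.phiClassEquiv : Quotient gl2zSetoid ≃ Quotient w1Setoid`.
* The **resolvent cubic form** `BinaryQuartic.resolventCubic f = X³ + cX²Y + (bd − 4ae)XY² +
  (ad² + b²e − 4ace)Y³` (a Mathlib `Cubic`): `Det(X·2A₁ − Y·2B_f) = 2g(X,Y)` (i.e.
  `g = 4·Det(A₁X − B_fY)`, `det_twoA1_sub_gram`), `I(f) = I(g) = r² − 3s`,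
  `J(f) = J(g) = −2r³ + 9rs − 27t` (`I_eq_resolventCubic`, `J_eq_resolventCubic`), **`φ` is
  discriminant preserving**: `Cubic.discr g = Δ(f)` (`discr_resolventCubic`), and for `γ ∈ GL₂(ℤ)`
  the resolvent cubic of `γ · f` is the translate `g(X − u)` (`toPoly_resolventCubic_subst`).

## References

* M. Bhargava, A. Shankar, Ann. of Math. (2) 181 (2015) 191–242 = arXiv:1006.1002; held text v2:
  §3.1 p. 14 (`I(g)`, `J(g)`, `Δ(g) = (4I³ − J²)/27`), §3.3 pp. 15–16 (`φ`, `A₁`, `B_f`, the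
  resolvent `g`, `W_{R,1}`, `F_{R,1}`, `ρ`, `SO(A₁, R)`, Theorem 3.7); published version §2.6,
  eqs. (26)–(28), Theorem 2.14, Proposition 2.16.
  [cite: BhargavaShankarAnnals2015, Thm 3.7 (arXiv:1006.1002v2 numbering; Thm 2.14 of the published version)]
* M. M. Wood, *Moduli spaces for rings and ideals*, Ph.D. thesis, Princeton University (2009),
  Lemma 4.4.2 (cited by Bhargava–Shankar as [MWt] for `ρ(PGL₂(ℤ)) = SO(A₁, ℤ)`; proved here).

## Design

All Gram matrices are doubled (`2A₁`, `2B_f`), which makes `φ`, `ρ` and the group actions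
integral and changes nothing in the orbit structure; `SO(A₁, ℤ)` is written for row vectors
(`B ↦ σ B σᵀ`), matching `BinaryQuartic.subst` (`(γ · f)(v) = f(vγ)`), under which `GL₂(ℤ)`- and
`PGL₂(ℤ)`-equivalence on `V_ℤ` coincide. The polynomial identities hold over any commutative
ring; the orbit statements are over `ℤ`.
-/

noncomputable section

open Matrix

namespace Literature.NumberTheory.EllipticCurves

namespace TernaryPairs

variable {R : Type*} [CommRing R]

/-- `2A₁ = !![0, 0, 1; 0, -2, 0; 1, 0, 0]`: twice the Gram matrix
`A₁ = !![0, 0, ½; 0, -1, 0; ½, 0, 0]` of the ternary quadratic form `pr − q²`, the first component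
of `φ(f) = (A₁, B_f)` (Bhargava–Shankar, held arXiv text §3.3 p. 15 = published eq. (26)); doubled
so as to be integral. [cite: BhargavaShankarAnnals2015, §3.3 p. 15 (the matrix A₁; arXiv:1006.1002v2 numbering)] -/
def twoA1 : Matrix (Fin 3) (Fin 3) R := !![0, 0, 1; 0, -2, 0; 1, 0, 0]

/-- The symmetric-square matrix `R(γ)` of `γ ∈ M₂(R)`: `ver((x,y)γ) = ver(x,y) R(γ)` for the
Veronese vector `ver(x,y) = (x², xy, y²)` (`veronese_vecMul_symSq`). Up to the factor `(det γ)⁻¹`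
and the reversal `(p,q,r) ↔ (r,q,p)` of coordinates this is Bhargava–Shankar's `ρ(γ)`
(held arXiv text §3.3 p. 16; published eq. (27)): their displayed matrix for `γ = (a b; c d)` is
`R((d c; b a))` (`symSq_reverse`). [cite: BhargavaShankarAnnals2015, §3.3 p. 16 (the map ρ; arXiv:1006.1002v2 numbering)] -/
def symSq (γ : Matrix (Fin 2) (Fin 2) R) : Matrix (Fin 3) (Fin 3) R :=
  !![γ 0 0 ^ 2, γ 0 0 * γ 0 1, γ 0 1 ^ 2;
    2 * γ 0 0 * γ 1 0, γ 0 0 * γ 1 1 + γ 0 1 * γ 1 0, 2 * γ 0 1 * γ 1 1;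
    γ 1 0 ^ 2, γ 1 0 * γ 1 1, γ 1 1 ^ 2]

/-- `ver((x,y)γ) = ver(x,y) · R(γ)` where `(x,y)γ = (xγ₀₀ + yγ₁₀, xγ₀₁ + yγ₁₁)` and
`ver(x,y) = (x², xy, y²)`. [folklore] -/
theorem veronese_vecMul_symSq (γ : Matrix (Fin 2) (Fin 2) R) (x y : R) :
    Matrix.vecMul ![x ^ 2, x * y, y ^ 2] (symSq γ) =
      ![(x * γ 0 0 + y * γ 1 0) ^ 2, (x * γ 0 0 + y * γ 1 0) * (x * γ 0 1 + y * γ 1 1),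
        (x * γ 0 1 + y * γ 1 1) ^ 2] := by
  ext i
  fin_cases i <;> simp [symSq, Matrix.vecMul, dotProduct, Fin.sum_univ_succ] <;> ring

/-- Bhargava–Shankar's displayed numerator of `ρ((a b; c d))`,
`!![d², cd, c²; 2bd, ad + bc, 2ac; b², ab, a²]`, is `R((d c; b a))`. [cite: BhargavaShankarAnnals2015, §3.3 p. 16 (the map ρ; arXiv:1006.1002v2 numbering)] -/
theorem symSq_reverse (a b c d : R) :
    symSq !![d, c; b, a] = !![d ^ 2, c * d, c ^ 2; 2 * b * d, a * d + b * c, 2 * a * c;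
      b ^ 2, a * b, a ^ 2] := by
  ext i j
  fin_cases i <;> fin_cases j <;> simp [symSq] <;> ring

/-- `R(1) = 1`. [folklore] -/
@[simp] theorem symSq_one : symSq (1 : Matrix (Fin 2) (Fin 2) R) = 1 := by
  ext i j
  fin_cases i <;> fin_cases j <;> simp [symSq]

/-- `R` is multiplicative: `R(γγ') = R(γ)R(γ')`. [folklore] -/
theorem symSq_mul (γ γ' : Matrix (Fin 2) (Fin 2) R) : symSq (γ * γ') = symSq γ * symSq γ' := by
  ext i j
  fin_cases i <;> fin_cases j <;>
    simp [symSq, Matrix.mul_apply, Fin.sum_univ_succ] <;> ring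

/-- `det R(γ) = (det γ)³`. [folklore] -/
theorem det_symSq (γ : Matrix (Fin 2) (Fin 2) R) : (symSq γ).det = γ.det ^ 3 := by
  simp [symSq, Matrix.det_fin_three, Matrix.det_fin_two]
  ring

/-- Entries of a congruence transform `S B Sᵀ` of a `3 × 3` Gram matrix. [folklore] -/
theorem mul_mul_transpose_apply (S B : Matrix (Fin 3) (Fin 3) R) (i j : Fin 3) :
    (S * B * Sᵀ) i j = ∑ k, ∑ l, S i k * B k l * S j l := by
  simp only [Matrix.mul_apply, Matrix.transpose_apply, Finset.sum_mul]
  rw [Finset.sum_comm]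

/-- `R(γ) (2A₁) R(γ)ᵀ = (det γ)² (2A₁)`: `R(γ)` is a similitude of the form `pr − q²`, i.e.
`(det γ)⁻¹ R(γ) ∈ SO(A₁)` ("the image of `PGL₂(R)` is contained in `SO(A₁, R)`", Bhargava–Shankar,
held arXiv text §3.3 p. 16). [cite: BhargavaShankarAnnals2015, §3.3 p. 16 (ρ(PGL₂) ⊆ SO(A₁); arXiv:1006.1002v2 numbering)] -/
theorem symSq_mul_twoA1_mul_transpose (γ : Matrix (Fin 2) (Fin 2) R) :
    symSq γ * twoA1 * (symSq γ)ᵀ = (γ.det ^ 2) • (twoA1 : Matrix (Fin 3) (Fin 3) R) := by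
  ext i j
  fin_cases i <;> fin_cases j <;>
    simp [symSq, twoA1, Matrix.mul_apply, Fin.sum_univ_succ, Matrix.det_fin_two] <;> ring

end TernaryPairs

namespace BinaryQuartic

open TernaryPairs

variable {R : Type*} [CommRing R]

/-- `2B_f = !![2a, b, 0; b, 2c, d; 0, d, 2e]`: twice the Gram matrix
`B_f = !![a, b/2, 0; b/2, c, d/2; 0, d/2, e]` of the second component of
`φ(f) = (A₁, B_f)`, `f = ax⁴ + bx³y + cx²y² + dxy³ + ey⁴` (Bhargava–Shankar, held arXiv text §3.3
p. 15 = published eq. (26)); `B_f` is the Gram matrix of the integral ternary form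
`ap² + bpq + cq² + dqr + er²`, whose restriction to the Veronese conic is `f` (`veronese_gram`).
[cite: BhargavaShankarAnnals2015, §3.3 p. 15 (the map φ; arXiv:1006.1002v2 numbering)] -/
def gram (f : BinaryQuartic R) : Matrix (Fin 3) (Fin 3) R :=
  !![2 * f.a, f.b, 0; f.b, 2 * f.c, f.d; 0, f.d, 2 * f.e]

/-- `ver(x,y) (2B_f) ver(x,y)ᵀ = 2 f(x,y)`: the ternary form with Gram matrix `B_f` restricts to
`f` on the Veronese conic. [folklore] -/
theorem veronese_gram (f : BinaryQuartic R) (x y : R) :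
    ![x ^ 2, x * y, y ^ 2] ⬝ᵥ (gram f).mulVec ![x ^ 2, x * y, y ^ 2] = 2 * f.eval x y := by
  simp [gram, Matrix.mulVec, dotProduct, Fin.sum_univ_succ, eval]
  ring

/-- The `F_{R,1}`-correction in the equivariance of `φ`: `2B_{γ·f} = R(γ)(2B_f)R(γ)ᵀ + u·(2A₁)`
with this `u = u(f, γ)` (`gram_subst`). [folklore] -/
def gramShift (f : BinaryQuartic R) (γ : Matrix (Fin 2) (Fin 2) R) : R :=
  -(2 * f.a * γ 0 0 ^ 2 * γ 1 0 ^ 2 + f.b * γ 0 0 ^ 2 * γ 1 0 * γ 1 1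
    + f.b * γ 0 0 * γ 0 1 * γ 1 0 ^ 2 + 2 * f.c * γ 0 0 * γ 0 1 * γ 1 0 * γ 1 1
    + f.d * γ 0 0 * γ 0 1 * γ 1 1 ^ 2 + f.d * γ 0 1 ^ 2 * γ 1 0 * γ 1 1
    + 2 * f.e * γ 0 1 ^ 2 * γ 1 1 ^ 2)

/-- **Equivariance of `φ`** ("`φ(γ · f)` and `ρ(γ) · φ(f)` are the same element of
`F_{ℤ,1}\W_{ℤ,1}`", Bhargava–Shankar, held arXiv text §3.3 p. 16; published §2.6 before Thm 2.14),
as an identity over any commutative ring for the substitution action `(γ · f)(v) = f(vγ)`: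
`2B_{γ·f} = R(γ) (2B_f) R(γ)ᵀ + u (2A₁)` with `u = gramShift f γ`.
[cite: BhargavaShankarAnnals2015, §3.3 p. 16 (equivariance of φ; arXiv:1006.1002v2 numbering)] -/
theorem gram_subst (f : BinaryQuartic R) (γ : Matrix (Fin 2) (Fin 2) R) :
    gram (f.subst γ) = symSq γ * gram f * (symSq γ)ᵀ + gramShift f γ • (twoA1 : Matrix _ _ R) := by
  ext i j
  rw [Matrix.add_apply, mul_mul_transpose_apply, Matrix.smul_apply, Fin.sum_univ_three,
    Fin.sum_univ_three, Fin.sum_univ_three, Fin.sum_univ_three]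
  fin_cases i <;> fin_cases j <;> simp [gram, subst, symSq, twoA1, gramShift] <;> ring

/-! ### The resolvent cubic form -/

/-- The **resolvent binary cubic form** of `f = ax⁴ + bx³y + cx²y² + dxy³ + ey⁴`:
`g(X,Y) = X³ + cX²Y + (bd − 4ae)XY² + (ad² + b²e − 4ace)Y³ = 4·Det(A₁X − B_fY)`
(Bhargava–Shankar, held arXiv text §3.3 p. 16, display; published §2.6: "the cubic resolvent
form of `f`"), as a (monic) Mathlib `Cubic`. [cite: BhargavaShankarAnnals2015, §3.3 p. 16 (resolvent cubic form g; arXiv:1006.1002v2 numbering)] -/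
def resolventCubic (f : BinaryQuartic R) : Cubic R :=
  ⟨1, f.c, f.b * f.d - 4 * f.a * f.e, f.a * f.d ^ 2 + f.b ^ 2 * f.e - 4 * f.a * f.c * f.e⟩

/-- `Det(X·2A₁ − Y·2B_f) = 2 g(X,Y)`, i.e. `4·Det(A₁X − B_fY) = g(X,Y)` (Bhargava–Shankar, held
arXiv text §3.3 p. 16: "`g(X,Y) = 4·det(A₁X − B_fY)` … we compute `g` to be
`X³ + cX²Y + (bd − 4ae)XY² + (ad² + b²e − 4ace)Y³`"). [cite: BhargavaShankarAnnals2015, §3.3 p. 16 (g = 4 det(A₁X − B_f Y); arXiv:1006.1002v2 numbering)] -/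
theorem det_twoA1_sub_gram (f : BinaryQuartic R) (x y : R) :
    (x • (twoA1 : Matrix _ _ R) - y • gram f).det =
      2 * (x ^ 3 + f.c * x ^ 2 * y + (f.b * f.d - 4 * f.a * f.e) * x * y ^ 2
        + (f.a * f.d ^ 2 + f.b ^ 2 * f.e - 4 * f.a * f.c * f.e) * y ^ 3) := by
  simp [gram, twoA1, Matrix.det_fin_three]
  ring

/-- The resolvent cubic is monic ("`g` is monic because `det(A₁) = 1/4`"). [cite: BhargavaShankarAnnals2015, §3.3 p. 16 (g monic; arXiv:1006.1002v2 numbering)] -/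
@[simp] theorem resolventCubic_a (f : BinaryQuartic R) : (resolventCubic f).a = 1 := rfl

/-- `I(f) = I(g) := r² − 3s` for the resolvent cubic `g = X³ + rX²Y + sXY² + tY³` of `f`
(Bhargava–Shankar, held arXiv text §3.1 p. 14 (`I(g)`), §3.3 p. 16: "we find that `I(f) = I(g)`").
[cite: BhargavaShankarAnnals2015, §3.3 p. 16 (I(f) = I(g); arXiv:1006.1002v2 numbering)] -/
theorem I_eq_resolventCubic (f : BinaryQuartic R) :
    f.I = (resolventCubic f).b ^ 2 - 3 * (resolventCubic f).c := by
  simp only [I, resolventCubic]; ring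

/-- `J(f) = J(g) := −2r³ + 9rs − 27t` for the resolvent cubic `g = X³ + rX²Y + sXY² + tY³` of `f`
(Bhargava–Shankar, held arXiv text §3.1 p. 14 (`J(g)`), §3.3 p. 16: "and `J(f) = J(g)`").
[cite: BhargavaShankarAnnals2015, §3.3 p. 16 (J(f) = J(g); arXiv:1006.1002v2 numbering)] -/
theorem J_eq_resolventCubic (f : BinaryQuartic R) :
    f.J = -2 * (resolventCubic f).b ^ 3 + 9 * (resolventCubic f).b * (resolventCubic f).c
      - 27 * (resolventCubic f).d := by
  simp only [J, resolventCubic]; ring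

/-- **`φ` is discriminant preserving**: `Disc(g) = Δ(f)` for the resolvent cubic `g` of `f`
(Bhargava–Shankar, published version §2.6: "the map `φ` is discriminant preserving, i.e., the
discriminant of an element of `V_ℤ` is equal to the discriminant of its image in `W_ℤ`", the
latter being the discriminant of the binary cubic form `4·Det(Ax − By)`; held arXiv text §3.1
p. 14: `Δ(g) = (4I(g)³ − J(g)²)/27`). Here `Cubic.discr` is Mathlib's discriminant of a cubic.
[cite: BhargavaShankarAnnals2015, §3.3 p. 16 and §3.1 p. 14 (Δ(g) = (4I³ − J²)/27; arXiv:1006.1002v2 numbering)] -/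
theorem discr_resolventCubic (f : BinaryQuartic R) : (resolventCubic f).discr = f.disc := by
  simp only [Cubic.discr, resolventCubic, disc]; ring

/-- The resolvent cubic forms of `f` and `γ · f` (`det γ = ±1`) differ by the translation
`X ↦ X − uY`, `u = gramShift f γ` (an `F_{ℤ,1}`-equivalence of monic cubic forms):
`Det(x·2A₁ − y·2B_{γ·f}) = Det((x − uy)·2A₁ − y·2B_f)`. [folklore] -/
theorem det_twoA1_sub_gram_subst (f : BinaryQuartic R) {γ : Matrix (Fin 2) (Fin 2) R}
    (hγ : γ.det ^ 2 = 1) (x y : R) :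
    (x • (twoA1 : Matrix _ _ R) - y • gram (f.subst γ)).det =
      ((x - gramShift f γ * y) • (twoA1 : Matrix _ _ R) - y • gram f).det := by
  have hA : symSq γ * twoA1 * (symSq γ)ᵀ = (twoA1 : Matrix (Fin 3) (Fin 3) R) := by
    rw [symSq_mul_twoA1_mul_transpose, hγ, one_smul]
  have key : x • (twoA1 : Matrix _ _ R) - y • gram (f.subst γ) =
      symSq γ * ((x - gramShift f γ * y) • (twoA1 : Matrix _ _ R) - y • gram f) * (symSq γ)ᵀ := by
    rw [gram_subst, Matrix.mul_sub, Matrix.sub_mul, Matrix.mul_smul, Matrix.smul_mul, hA,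
      Matrix.mul_smul, Matrix.smul_mul]
    module
  rw [key, Matrix.det_mul, Matrix.det_mul, Matrix.det_transpose, det_symSq]
  have h6 : (γ.det ^ 3) * (γ.det ^ 3) = 1 := by
    calc (γ.det ^ 3) * (γ.det ^ 3) = (γ.det ^ 2) ^ 3 := by ring
      _ = 1 := by rw [hγ, one_pow]
  linear_combination ((x - gramShift f γ * y) • (twoA1 : Matrix _ _ R) - y • gram f).det * h6


/-- For `γ ∈ GL₂(ℤ)`, the resolvent cubic of `γ · f` is the translate `g_f(X − u, 1)`,
`u = gramShift f γ`, of that of `f`: `GL₂(ℤ)`-equivalent integral quartic forms have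
`ℤ`-translation-equivalent (i.e. `F_{ℤ,1}`-equivalent) monic resolvent cubics, so define the same
monogenised cubic ring up to `(C, x) ∼ (C, x + n)` (Bhargava–Shankar, held arXiv text §1.3 p. 5
and §3.1 p. 14; the map `ψ` of the published version, eq. (28)). [folklore] -/
theorem toPoly_resolventCubic_subst (f : BinaryQuartic ℤ) {γ : Matrix (Fin 2) (Fin 2) ℤ}
    (hγ : IsUnit γ.det) :
    (resolventCubic (f.subst γ)).toPoly =
      (resolventCubic f).toPoly.comp (Polynomial.X - Polynomial.C (gramShift f γ)) := by
  have h2 : γ.det ^ 2 = 1 := by rcases Int.isUnit_iff.mp hγ with h | h <;> rw [h] <;> norm_num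
  apply Polynomial.funext
  intro x
  have key := det_twoA1_sub_gram_subst f h2 x 1
  rw [det_twoA1_sub_gram, det_twoA1_sub_gram] at key
  have key' := mul_left_cancel₀ two_ne_zero key
  simp only [Cubic.toPoly, resolventCubic, Polynomial.eval_comp, Polynomial.eval_add,
    Polynomial.eval_mul, Polynomial.eval_C, Polynomial.eval_pow, Polynomial.eval_X,
    Polynomial.eval_sub, map_one, one_mul]
  linear_combination key'

end BinaryQuartic


namespace TernaryPairs

/-! ### `SO(A₁, ℤ)` and the equality `SO(A₁, ℤ) = ρ(PGL₂(ℤ))` -/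

section CommRing

variable {R : Type*} [CommRing R]

/-- Entries of `σ (2A₁) σᵀ`: the symmetric bilinear form `⟨v, w⟩ = v₀w₂ − 2v₁w₁ + v₂w₀`
(twice the polar form of `pr − q²`) evaluated on the rows of `σ`. [folklore] -/
theorem mul_twoA1_mul_transpose_apply (σ : Matrix (Fin 3) (Fin 3) R) (i j : Fin 3) :
    (σ * (twoA1 : Matrix (Fin 3) (Fin 3) R) * σᵀ) i j
      = σ i 0 * σ j 2 - 2 * σ i 1 * σ j 1 + σ i 2 * σ j 0 := by
  rw [mul_mul_transpose_apply, Fin.sum_univ_three, Fin.sum_univ_three, Fin.sum_univ_three,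
    Fin.sum_univ_three]
  simp [twoA1]
  ring

end CommRing

/-- `SO(A₁, ℤ)`: the integral points of the special orthogonal group of the ternary quadratic
form with Gram matrix `A₁` (equivalently `2A₁`), written for the row-vector convention
`v ↦ vσ` (so that Gram matrices transform by `B ↦ σ B σᵀ`): `det σ = 1` and `σ A₁ σᵀ = A₁`
(Bhargava–Shankar, held arXiv text §3.3 p. 16; published §2.6, Thm 2.14).
[cite: BhargavaShankarAnnals2015, §3.3 p. 16 (SO(A₁, R); arXiv:1006.1002v2 numbering)] -/
def soA1 : Set (Matrix (Fin 3) (Fin 3) ℤ) :=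
  {σ | σ.det = 1 ∧ σ * twoA1 * σᵀ = twoA1}

/-- Membership in `SO(A₁, ℤ)` (definitional unfolding). [folklore] -/
theorem mem_soA1_iff (σ : Matrix (Fin 3) (Fin 3) ℤ) :
    σ ∈ soA1 ↔ σ.det = 1 ∧ σ * twoA1 * σᵀ = twoA1 := Iff.rfl

/-- `1 ∈ SO(A₁, ℤ)`. [folklore] -/
theorem one_mem_soA1 : (1 : Matrix (Fin 3) (Fin 3) ℤ) ∈ soA1 := by
  simp [mem_soA1_iff]

/-- `SO(A₁, ℤ)` is closed under products. [folklore] -/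
theorem mul_mem_soA1 {σ σ' : Matrix (Fin 3) (Fin 3) ℤ} (h : σ ∈ soA1) (h' : σ' ∈ soA1) :
    σ * σ' ∈ soA1 := by
  refine ⟨by rw [Matrix.det_mul, h.1, h'.1, one_mul], ?_⟩
  rw [Matrix.transpose_mul]
  calc σ * σ' * twoA1 * (σ'ᵀ * σᵀ) = σ * (σ' * twoA1 * σ'ᵀ) * σᵀ := by
        simp only [Matrix.mul_assoc]
    _ = twoA1 := by rw [h'.2, h.2]

/-- `SO(A₁, ℤ)` is closed under inverses (an integral matrix of determinant `1` has an integral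
inverse). [folklore] -/
theorem inv_mem_soA1 {σ : Matrix (Fin 3) (Fin 3) ℤ} (h : σ ∈ soA1) : σ⁻¹ ∈ soA1 := by
  have hu : IsUnit σ.det := by rw [h.1]; exact isUnit_one
  refine ⟨by rw [Matrix.det_nonsing_inv, h.1, Ring.inverse_one], ?_⟩
  calc σ⁻¹ * twoA1 * σ⁻¹ᵀ = σ⁻¹ * (σ * twoA1 * σᵀ) * σ⁻¹ᵀ := by rw [h.2]
    _ = σ⁻¹ * σ * twoA1 * (σ⁻¹ * σ)ᵀ := by
        rw [Matrix.transpose_mul]; simp only [Matrix.mul_assoc]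
    _ = twoA1 := by
        rw [Matrix.nonsing_inv_mul σ hu, Matrix.one_mul, Matrix.transpose_one, Matrix.mul_one]

/-- `ρ(γ) := (det γ) · R(γ)` for `γ ∈ M₂(ℤ)`; for `γ ∈ GL₂(ℤ)` (`det γ = ±1 = (det γ)⁻¹`) this
is Bhargava–Shankar's `ρ(γ) = (det γ)⁻¹ R(γ) ∈ SO(A₁, ℤ)` (held arXiv text §3.3 p. 16; published
eq. (27)), in the coordinates of `symSq`. [cite: BhargavaShankarAnnals2015, §3.3 p. 16 (the map ρ : PGL₂ → SO(A₁); arXiv:1006.1002v2 numbering)] -/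
def rho (γ : Matrix (Fin 2) (Fin 2) ℤ) : Matrix (Fin 3) (Fin 3) ℤ :=
  γ.det • symSq γ

/-- `ρ` is multiplicative. [folklore] -/
theorem rho_mul (γ γ' : Matrix (Fin 2) (Fin 2) ℤ) : rho (γ * γ') = rho γ * rho γ' := by
  rw [rho, rho, rho, symSq_mul, Matrix.det_mul, Matrix.smul_mul, Matrix.mul_smul, smul_smul]

/-- `ρ(1) = 1`. [folklore] -/
@[simp] theorem rho_one : rho (1 : Matrix (Fin 2) (Fin 2) ℤ) = 1 := by
  simp [rho]

/-- `det ρ(γ) = (det γ)⁶`. [folklore] -/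
theorem det_rho (γ : Matrix (Fin 2) (Fin 2) ℤ) : (rho γ).det = γ.det ^ 6 := by
  rw [rho, Matrix.det_smul, det_symSq, Fintype.card_fin]
  ring

/-- `ρ(γ) (2A₁) ρ(γ)ᵀ = (det γ)⁴ (2A₁)`. [folklore] -/
theorem rho_mul_twoA1_mul_transpose (γ : Matrix (Fin 2) (Fin 2) ℤ) :
    rho γ * twoA1 * (rho γ)ᵀ = (γ.det ^ 4) • twoA1 := by
  rw [rho, Matrix.transpose_smul, Matrix.smul_mul, Matrix.smul_mul, Matrix.mul_smul,
    symSq_mul_twoA1_mul_transpose, smul_smul, smul_smul]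
  congr 1
  ring

/-- The entries of `ρ(γ)` (definitional unfolding). [folklore] -/
theorem rho_apply (γ : Matrix (Fin 2) (Fin 2) ℤ) (i j : Fin 3) :
    rho γ i j = γ.det * symSq γ i j := by
  simp [rho]

/-- **`ρ(PGL₂(ℤ)) ⊆ SO(A₁, ℤ)`**: for `γ ∈ GL₂(ℤ)`, `ρ(γ) ∈ SO(A₁, ℤ)` (Bhargava–Shankar, held
arXiv text §3.3 p. 16: "The image of `PGL₂(R)` is contained in the orthogonal group `SO(A₁, R)`
because `A₁` is the Gram matrix of the ternary form `q² − pr`").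
[cite: BhargavaShankarAnnals2015, §3.3 p. 16 (ρ(PGL₂) ⊆ SO(A₁); arXiv:1006.1002v2 numbering)] -/
theorem rho_mem_soA1 {γ : Matrix (Fin 2) (Fin 2) ℤ} (hγ : IsUnit γ.det) : rho γ ∈ soA1 := by
  rcases Int.isUnit_iff.mp hγ with h | h
  · exact ⟨by rw [det_rho, h]; norm_num, by rw [rho_mul_twoA1_mul_transpose, h]; norm_num⟩
  · exact ⟨by rw [det_rho, h]; norm_num, by rw [rho_mul_twoA1_mul_transpose, h]; norm_num⟩

/-- **Primitive integral isotropic vectors of `pr − q²` are `± ver(s, t)`**: if `v₀v₂ = v₁²` and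
the entries of `v = (v₀, v₁, v₂) ∈ ℤ³` generate the unit ideal, then `v = ε (s², st, t²)` with
`ε = ±1` (the integral points of the Veronese conic). [folklore] -/
theorem exists_eq_veronese_of_isotropic {v₀ v₁ v₂ : ℤ} (hiso : v₀ * v₂ = v₁ ^ 2)
    (hprim : ∃ c₀ c₁ c₂ : ℤ, c₀ * v₀ + c₁ * v₁ + c₂ * v₂ = 1) :
    ∃ ε s t : ℤ, (ε = 1 ∨ ε = -1) ∧ v₀ = ε * s ^ 2 ∧ v₁ = ε * (s * t) ∧ v₂ = ε * t ^ 2 := by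
  obtain ⟨c₀, c₁, c₂, hc⟩ := hprim
  -- `gcd(v₀, v₂) = 1`
  have hgcd : Int.gcd v₀ v₂ = 1 := by
    have h0 : (Int.gcd v₀ v₂ : ℤ) ∣ v₀ := Int.gcd_dvd_left ..
    have h2 : (Int.gcd v₀ v₂ : ℤ) ∣ v₂ := Int.gcd_dvd_right ..
    have h1 : (Int.gcd v₀ v₂ : ℤ) ∣ v₁ := by
      have h : (Int.gcd v₀ v₂ : ℤ) ^ 2 ∣ v₁ ^ 2 := by rw [← hiso, sq]; exact mul_dvd_mul h0 h2
      exact (Int.pow_dvd_pow_iff two_ne_zero).mp h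
    have hone : (Int.gcd v₀ v₂ : ℤ) ∣ 1 := by
      rw [← hc]
      exact dvd_add (dvd_add (dvd_mul_of_dvd_right h0 _) (dvd_mul_of_dvd_right h1 _))
        (dvd_mul_of_dvd_right h2 _)
    exact Nat.dvd_one.mp (Int.natCast_dvd_natCast.mp hone)
  obtain ⟨s, hs⟩ := Int.sq_of_gcd_eq_one hgcd hiso
  obtain ⟨t, ht⟩ := Int.sq_of_gcd_eq_one (Int.gcd_comm v₀ v₂ ▸ hgcd) ((mul_comm v₂ v₀).trans hiso)
  -- same signs
  have claimA : ∀ ε : ℤ, (ε = 1 ∨ ε = -1) → v₀ = ε * s ^ 2 → v₂ = ε * t ^ 2 →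
      ∃ ε s t : ℤ, (ε = 1 ∨ ε = -1) ∧ v₀ = ε * s ^ 2 ∧ v₁ = ε * (s * t) ∧ v₂ = ε * t ^ 2 := by
    intro ε hε h0 h2
    have hε2 : ε ^ 2 = 1 := by rcases hε with h | h <;> rw [h] <;> norm_num
    have hv1 : v₁ ^ 2 = (ε * (s * t)) ^ 2 := by
      rw [← hiso, h0, h2]; ring
    rcases sq_eq_sq_iff_eq_or_eq_neg.mp hv1 with h1 | h1
    · exact ⟨ε, s, t, hε, h0, h1, h2⟩
    · exact ⟨ε, s, -t, hε, h0, by rw [h1]; ring, by rw [h2]; ring⟩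
  -- opposite signs (degenerate: then `v₁ = 0` and `st = 0`)
  have claimB : ∀ ε : ℤ, (ε = 1 ∨ ε = -1) → v₀ = ε * s ^ 2 → v₂ = -ε * t ^ 2 →
      ∃ ε s t : ℤ, (ε = 1 ∨ ε = -1) ∧ v₀ = ε * s ^ 2 ∧ v₁ = ε * (s * t) ∧ v₂ = ε * t ^ 2 := by
    intro ε hε h0 h2
    have hε2 : ε ^ 2 = 1 := by rcases hε with h | h <;> rw [h] <;> norm_num
    have hsum : v₁ ^ 2 + (s * t) ^ 2 = 0 := by
      rw [← hiso, h0, h2]; linear_combination (-(s * t) ^ 2) * hε2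
    have hv1 : v₁ = 0 :=
      (pow_eq_zero_iff two_ne_zero).mp (by linarith [sq_nonneg v₁, sq_nonneg (s * t)])
    have hst : s * t = 0 :=
      (pow_eq_zero_iff two_ne_zero).mp (by linarith [sq_nonneg v₁, sq_nonneg (s * t)])
    rcases mul_eq_zero.mp hst with hs0 | ht0
    · refine ⟨-ε, 0, t, ?_, ?_, ?_, ?_⟩
      · rcases hε with h | h <;> rw [h] <;> norm_num
      · rw [h0, hs0]; ring
      · rw [hv1]; ring
      · rw [h2]
    · exact ⟨ε, s, 0, hε, h0, by rw [hv1]; ring, by rw [h2, ht0]; ring⟩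
  rcases hs with h0 | h0 <;> rcases ht with h2 | h2
  · exact claimA 1 (Or.inl rfl) (by rw [h0]; ring) (by rw [h2]; ring)
  · exact claimB 1 (Or.inl rfl) (by rw [h0]; ring) (by rw [h2]; ring)
  · exact claimB (-1) (Or.inr rfl) (by rw [h0]; ring) (by rw [h2]; ring)
  · exact claimA (-1) (Or.inr rfl) (by rw [h0]; ring) (by rw [h2]; ring)

/-- An element of `SO(A₁, ℤ)` whose first and last rows are `e₀` and `e₂` is the identity
(the stabiliser computation behind `SO(A₁, ℤ) = ρ(PGL₂(ℤ))`). [folklore] -/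
theorem eq_one_of_mem_soA1 {τ : Matrix (Fin 3) (Fin 3) ℤ} (hτ : τ ∈ soA1)
    (h00 : τ 0 0 = 1) (h01 : τ 0 1 = 0) (h02 : τ 0 2 = 0)
    (h20 : τ 2 0 = 0) (h21 : τ 2 1 = 0) (h22 : τ 2 2 = 1) : τ = 1 := by
  obtain ⟨hdet, hA⟩ := hτ
  have e : ∀ i j, τ i 0 * τ j 2 - 2 * τ i 1 * τ j 1 + τ i 2 * τ j 0 = twoA1 i j := fun i j ↦
    (mul_twoA1_mul_transpose_apply τ i j).symm.trans (congr_fun (congr_fun hA i) j)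
  have h12 : τ 1 2 = 0 := by
    have h := e 0 1
    rw [h00, h01, h02] at h
    simpa [twoA1] using h
  have h10 : τ 1 0 = 0 := by
    have h := e 2 1
    rw [h20, h21, h22] at h
    simpa [twoA1] using h
  have h11 : τ 1 1 = 1 := by
    have hd := hdet
    rw [Matrix.det_fin_three, h00, h01, h02, h10, h12, h20, h21, h22] at hd
    linarith
  ext i j
  fin_cases i <;> fin_cases j <;> simp [h00, h01, h02, h10, h11, h12, h20, h21, h22]

/-- **`SO(A₁, ℤ) = ρ(PGL₂(ℤ))`**: every `σ ∈ SL₃(ℤ)` with `σ A₁ σᵀ = A₁` is `ρ(γ)` for some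
`γ ∈ GL₂(ℤ)` (Bhargava–Shankar, held arXiv text §3.3 p. 16: "In fact, the image of `PGL₂(R)` is
equal to `SO(A₁, R)`; the proof parallels that of Lemma 4.4.2 in [MWt]" (M. M. Wood, *Moduli
spaces for rings and ideals*, Ph.D. thesis, Princeton 2009); published §2.6, before Thm 2.14,
citing [MWt, Lemma 4.4.2]). Proof: the first and last rows of `σ` are primitive isotropic, hence
`ε ver(s₀,t₀)`, `ε ver(s₂,t₂)` with `s₀t₂ − t₀s₂ = ±1` (`exists_eq_veronese_of_isotropic`); for
the corresponding `γ`, `σ ρ(γ)⁻¹ ∈ SO(A₁, ℤ)` fixes `e₀` and `e₂`, so is `1` (`eq_one_of_mem_soA1`).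
[cite: BhargavaShankarAnnals2015, §3.3 p. 16 (ρ(PGL₂(ℤ)) = SO(A₁, ℤ); arXiv:1006.1002v2 numbering)] -/
theorem exists_rho_eq_of_mem_soA1 {σ : Matrix (Fin 3) (Fin 3) ℤ} (hσ : σ ∈ soA1) :
    ∃ γ : Matrix (Fin 2) (Fin 2) ℤ, IsUnit γ.det ∧ rho γ = σ := by
  obtain ⟨hdet, hA⟩ := hσ
  have e : ∀ i j, σ i 0 * σ j 2 - 2 * σ i 1 * σ j 1 + σ i 2 * σ j 0 = twoA1 i j := fun i j ↦
    (mul_twoA1_mul_transpose_apply σ i j).symm.trans (congr_fun (congr_fun hA i) j)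
  -- the rows of `σ` are primitive, as `σ · adj σ = 1`
  have hadj : σ * σ.adjugate = 1 := by rw [Matrix.mul_adjugate, hdet, one_smul]
  have prim : ∀ i, ∃ c₀ c₁ c₂ : ℤ, c₀ * σ i 0 + c₁ * σ i 1 + c₂ * σ i 2 = 1 := by
    intro i
    have h := congr_fun (congr_fun hadj i) i
    rw [Matrix.mul_apply, Fin.sum_univ_three, Matrix.one_apply_eq] at h
    exact ⟨σ.adjugate 0 i, σ.adjugate 1 i, σ.adjugate 2 i, by linear_combination h⟩
  -- rows `0` and `2` are isotropic
  have iso0 : σ 0 0 * σ 0 2 = σ 0 1 ^ 2 := by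
    have h := e 0 0
    simp only [twoA1, Matrix.of_apply, Matrix.cons_val', Matrix.cons_val_zero,
      Matrix.empty_val', Matrix.cons_val_fin_one] at h
    linarith
  have iso2 : σ 2 0 * σ 2 2 = σ 2 1 ^ 2 := by
    have h := e 2 2
    have hA22 : (twoA1 : Matrix (Fin 3) (Fin 3) ℤ) 2 2 = 0 := by simp [twoA1]
    rw [hA22] at h
    linarith
  obtain ⟨ε₀, s₀, t₀, hε₀, h00, h01, h02⟩ := exists_eq_veronese_of_isotropic iso0 (prim 0)
  obtain ⟨ε₂, s₂, t₂, hε₂, h20, h21, h22⟩ := exists_eq_veronese_of_isotropic iso2 (prim 2)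
  -- `⟨r₀, r₂⟩ = 1` forces `ε₀ = ε₂` and `(s₀t₂ − t₀s₂)² = 1`
  have cross : ε₀ * ε₂ * (s₀ * t₂ - t₀ * s₂) ^ 2 = 1 := by
    have h := e 0 2
    have hA02 : (twoA1 : Matrix (Fin 3) (Fin 3) ℤ) 0 2 = 1 := by simp [twoA1]
    rw [hA02, h00, h01, h02, h20, h21, h22] at h
    linear_combination h
  have hsigns : ε₂ = ε₀ ∧ (s₀ * t₂ - t₀ * s₂) ^ 2 = 1 := by
    have hsq := sq_nonneg (s₀ * t₂ - t₀ * s₂)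
    rcases hε₀ with h | h <;> rcases hε₂ with h' | h' <;> rw [h, h'] at cross ⊢ <;>
      first
      | exact ⟨rfl, by linarith⟩
      | exact absurd cross (by linarith)
  obtain ⟨hε, hδ⟩ := hsigns
  rw [hε] at h20 h21 h22
  have hε2 : ε₀ ^ 2 = 1 := by rcases hε₀ with h | h <;> rw [h] <;> norm_num
  -- the element `γ ∈ GL₂(ℤ)` with `det γ = ε₀` whose `ρ` has the same first and last rows as `σ`
  obtain ⟨κ, hκ⟩ : ∃ κ : ℤ, κ = ε₀ * (s₀ * t₂ - t₀ * s₂) := ⟨_, rfl⟩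
  have hκ2 : κ ^ 2 = 1 := by
    rw [hκ]; linear_combination (s₀ * t₂ - t₀ * s₂) ^ 2 * hε2 + hδ
  let γ : Matrix (Fin 2) (Fin 2) ℤ := !![s₀, t₀; κ * s₂, κ * t₂]
  have hγdet : γ.det = ε₀ := by
    rw [Matrix.det_fin_two]
    simp only [γ, Matrix.of_apply, Matrix.cons_val', Matrix.cons_val_zero, Matrix.cons_val_one,
      Matrix.empty_val', Matrix.cons_val_fin_one]
    linear_combination (s₀ * t₂ - t₀ * s₂) * hκ + ε₀ * hδ
  have hγunit : IsUnit γ.det := by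
    rcases hε₀ with h | h
    · rw [hγdet, h]; exact isUnit_one
    · rw [hγdet, h]; exact isUnit_one.neg
  have r00 : rho γ 0 0 = σ 0 0 := by rw [h00, rho_apply, hγdet]; simp [symSq, γ]
  have r01 : rho γ 0 1 = σ 0 1 := by rw [h01, rho_apply, hγdet]; simp [symSq, γ]
  have r02 : rho γ 0 2 = σ 0 2 := by rw [h02, rho_apply, hγdet]; simp [symSq, γ]
  have e20 : symSq γ 2 0 = (κ * s₂) ^ 2 := by simp [symSq, γ]
  have e21 : symSq γ 2 1 = κ * s₂ * (κ * t₂) := by simp [symSq, γ]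
  have e22 : symSq γ 2 2 = (κ * t₂) ^ 2 := by simp [symSq, γ]
  have r20 : rho γ 2 0 = σ 2 0 := by
    rw [h20, rho_apply, hγdet, e20]; linear_combination ε₀ * s₂ ^ 2 * hκ2
  have r21 : rho γ 2 1 = σ 2 1 := by
    rw [h21, rho_apply, hγdet, e21]; linear_combination ε₀ * (s₂ * t₂) * hκ2
  have r22 : rho γ 2 2 = σ 2 2 := by
    rw [h22, rho_apply, hγdet, e22]; linear_combination ε₀ * t₂ ^ 2 * hκ2
  -- `τ = σ ρ(γ)⁻¹ ∈ SO(A₁, ℤ)` fixes `e₀` and `e₂`, hence is `1`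
  have hinvunit : IsUnit γ⁻¹.det := Matrix.isUnit_nonsing_inv_det_iff.mpr hγunit
  have hρρ : rho γ * rho γ⁻¹ = 1 := by rw [← rho_mul, Matrix.mul_nonsing_inv γ hγunit, rho_one]
  have hρρ' : rho γ⁻¹ * rho γ = 1 := by rw [← rho_mul, Matrix.nonsing_inv_mul γ hγunit, rho_one]
  have hτmem : σ * rho γ⁻¹ ∈ soA1 := mul_mem_soA1 ⟨hdet, hA⟩ (rho_mem_soA1 hinvunit)
  have hτ0 : ∀ j, (σ * rho γ⁻¹) 0 j = (1 : Matrix (Fin 3) (Fin 3) ℤ) 0 j := by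
    intro j
    rw [← hρρ, Matrix.mul_apply, Matrix.mul_apply, Fin.sum_univ_three, Fin.sum_univ_three, r00,
      r01, r02]
  have hτ2 : ∀ j, (σ * rho γ⁻¹) 2 j = (1 : Matrix (Fin 3) (Fin 3) ℤ) 2 j := by
    intro j
    rw [← hρρ, Matrix.mul_apply, Matrix.mul_apply, Fin.sum_univ_three, Fin.sum_univ_three, r20,
      r21, r22]
  have hτ1 : σ * rho γ⁻¹ = 1 :=
    eq_one_of_mem_soA1 hτmem (by simpa using hτ0 0) (by simpa using hτ0 1) (by simpa using hτ0 2)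
      (by simpa using hτ2 0) (by simpa using hτ2 1) (by simpa using hτ2 2)
  refine ⟨γ, hγunit, ?_⟩
  calc rho γ = σ * rho γ⁻¹ * rho γ := by rw [hτ1, Matrix.one_mul]
    _ = σ := by rw [Matrix.mul_assoc, hρρ', Matrix.mul_one]

/-- `SO(A₁, ℤ)` is exactly the image of `GL₂(ℤ)` (equivalently of `PGL₂(ℤ)`) under `ρ`
(Bhargava–Shankar, held arXiv text §3.3 p. 16; [MWt, Lemma 4.4.2]).
[cite: BhargavaShankarAnnals2015, §3.3 p. 16 (ρ(PGL₂(ℤ)) = SO(A₁, ℤ); arXiv:1006.1002v2 numbering)] -/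
theorem soA1_eq_image_rho :
    soA1 = rho '' {γ : Matrix (Fin 2) (Fin 2) ℤ | IsUnit γ.det} := by
  ext σ
  constructor
  · intro h
    obtain ⟨γ, hγ, rfl⟩ := exists_rho_eq_of_mem_soA1 h
    exact ⟨γ, hγ, rfl⟩
  · rintro ⟨γ, hγ, rfl⟩
    exact rho_mem_soA1 hγ

end TernaryPairs

namespace TernaryPairs

/-! ### `W_{ℤ,1}` and its `F_{ℤ,1} × SO(A₁, ℤ)`-classes -/

/-- Doubled Gram matrices of *integral* ternary quadratic forms: symmetric integer `3 × 3`
matrices with even diagonal (the form `Σ_{i ≤ j} q_{ij} x_i x_j`, `q_{ij} ∈ ℤ`, has Gram matrix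
with entries `q_{ii}` and `q_{ij}/2`). The pairs `(A₁, B)` with `2B` of this shape form
`W_{ℤ,1} = {(A, B) ∈ W_ℤ : A = A₁}` (Bhargava–Shankar, held arXiv text §3.3 p. 16; published §2.6).
[cite: BhargavaShankarAnnals2015, §3.3 p. 16 (the set W_{ℤ,1}; arXiv:1006.1002v2 numbering)] -/
def IsEvenSymm (B : Matrix (Fin 3) (Fin 3) ℤ) : Prop :=
  B.IsSymm ∧ ∀ i, 2 ∣ B i i

/-- `2A₁` is a doubled integral Gram matrix. [folklore] -/
theorem isEvenSymm_twoA1 : IsEvenSymm (twoA1 : Matrix (Fin 3) (Fin 3) ℤ) := by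
  refine ⟨Matrix.IsSymm.ext fun i j ↦ ?_, fun i ↦ ?_⟩
  · fin_cases i <;> fin_cases j <;> rfl
  · fin_cases i <;> simp [twoA1]

/-- Sums of doubled integral Gram matrices are such. [folklore] -/
theorem IsEvenSymm.add {B B' : Matrix (Fin 3) (Fin 3) ℤ} (hB : IsEvenSymm B) (hB' : IsEvenSymm B') :
    IsEvenSymm (B + B') :=
  ⟨hB.1.add hB'.1, fun i ↦ by rw [Matrix.add_apply]; exact dvd_add (hB.2 i) (hB'.2 i)⟩

/-- Integer multiples of doubled integral Gram matrices are such. [folklore] -/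
theorem IsEvenSymm.smul {B : Matrix (Fin 3) (Fin 3) ℤ} (hB : IsEvenSymm B) (u : ℤ) :
    IsEvenSymm (u • B) :=
  ⟨hB.1.smul u, fun i ↦ by rw [Matrix.smul_apply, smul_eq_mul]; exact (hB.2 i).mul_left u⟩

/-- Integral changes of variables preserve integrality of ternary quadratic forms:
`σ B σᵀ` is a doubled integral Gram matrix if `B` is. [folklore] -/
theorem IsEvenSymm.conj {B : Matrix (Fin 3) (Fin 3) ℤ} (hB : IsEvenSymm B)
    (σ : Matrix (Fin 3) (Fin 3) ℤ) : IsEvenSymm (σ * B * σᵀ) := by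
  refine ⟨?_, fun i ↦ ?_⟩
  · show (σ * B * σᵀ)ᵀ = σ * B * σᵀ
    rw [Matrix.transpose_mul, Matrix.transpose_mul, Matrix.transpose_transpose, hB.1.eq,
      Matrix.mul_assoc]
  · obtain ⟨k₀, hk₀⟩ := hB.2 0
    obtain ⟨k₁, hk₁⟩ := hB.2 1
    obtain ⟨k₂, hk₂⟩ := hB.2 2
    rw [mul_mul_transpose_apply, Fin.sum_univ_three, Fin.sum_univ_three, Fin.sum_univ_three,
      Fin.sum_univ_three, hB.1.apply 0 1, hB.1.apply 0 2, hB.1.apply 1 2, hk₀, hk₁, hk₂]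
    exact ⟨k₀ * σ i 0 ^ 2 + k₁ * σ i 1 ^ 2 + k₂ * σ i 2 ^ 2 + σ i 0 * σ i 1 * B 0 1
      + σ i 0 * σ i 2 * B 0 2 + σ i 1 * σ i 2 * B 1 2, by ring⟩

/-- **`(F_{ℤ,1} × SO(A₁, ℤ))`-equivalence on `W_{ℤ,1}`** (doubled): `B' = σ B σᵀ + u (2A₁)` with
`σ ∈ SO(A₁, ℤ)` (acting on both components of `(A₁, B)`, and fixing `A₁`) and `u ∈ ℤ` (the
element `(1 0; u 1) ∈ F_{ℤ,1}` acts on `W_ℤ` by `(A, B) ↦ (A, B + uA)`) (Bhargava–Shankar, held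
arXiv text §3.3 p. 16, Thm 3.7; published §2.6, Thm 2.14).
[cite: BhargavaShankarAnnals2015, Thm 3.7 (arXiv:1006.1002v2 numbering; Thm 2.14 of the published version)] -/
def W1Equiv (B B' : Matrix (Fin 3) (Fin 3) ℤ) : Prop :=
  ∃ σ ∈ soA1, ∃ u : ℤ, B' = σ * B * σᵀ + u • twoA1

/-- `W1Equiv` is reflexive. [folklore] -/
theorem W1Equiv.refl (B : Matrix (Fin 3) (Fin 3) ℤ) : W1Equiv B B :=
  ⟨1, one_mem_soA1, 0, by simp⟩

/-- `W1Equiv` is symmetric. [folklore] -/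
theorem W1Equiv.symm {B B' : Matrix (Fin 3) (Fin 3) ℤ} (h : W1Equiv B B') : W1Equiv B' B := by
  obtain ⟨σ, hσ, u, rfl⟩ := h
  have hu : IsUnit σ.det := by rw [hσ.1]; exact isUnit_one
  refine ⟨σ⁻¹, inv_mem_soA1 hσ, -u, ?_⟩
  rw [Matrix.mul_add, Matrix.add_mul, Matrix.mul_smul, Matrix.smul_mul, (inv_mem_soA1 hσ).2]
  have key : σ⁻¹ * (σ * B * σᵀ) * σ⁻¹ᵀ = B := by
    calc σ⁻¹ * (σ * B * σᵀ) * σ⁻¹ᵀ = σ⁻¹ * σ * B * (σ⁻¹ * σ)ᵀ := by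
          rw [Matrix.transpose_mul]; simp only [Matrix.mul_assoc]
      _ = B := by
          rw [Matrix.nonsing_inv_mul σ hu, Matrix.one_mul, Matrix.transpose_one, Matrix.mul_one]
  rw [key, neg_smul, add_neg_cancel_right]

/-- `W1Equiv` is transitive. [folklore] -/
theorem W1Equiv.trans {B B' B'' : Matrix (Fin 3) (Fin 3) ℤ} (h₁ : W1Equiv B B')
    (h₂ : W1Equiv B' B'') : W1Equiv B B'' := by
  obtain ⟨σ, hσ, u, rfl⟩ := h₁
  obtain ⟨σ', hσ', u', rfl⟩ := h₂
  refine ⟨σ' * σ, mul_mem_soA1 hσ' hσ, u + u', ?_⟩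
  rw [Matrix.mul_add, Matrix.add_mul, Matrix.mul_smul, Matrix.smul_mul, hσ'.2,
    Matrix.transpose_mul, add_smul]
  simp only [Matrix.mul_assoc, add_assoc]

/-- `W1Equiv` is an equivalence relation. [folklore] -/
theorem W1Equiv.equivalence : Equivalence W1Equiv :=
  ⟨W1Equiv.refl, W1Equiv.symm, W1Equiv.trans⟩

/-- `W1Equiv` preserves `W_{ℤ,1}` (doubled integral Gram matrices). [folklore] -/
theorem IsEvenSymm.of_w1Equiv {B B' : Matrix (Fin 3) (Fin 3) ℤ} (hB : IsEvenSymm B)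
    (h : W1Equiv B B') : IsEvenSymm B' := by
  obtain ⟨σ, -, u, rfl⟩ := h
  exact (hB.conj σ).add (isEvenSymm_twoA1.smul u)

/-- The `F_{ℤ,1}`-moves on either side do not change the class: `B + u(2A₁) ~ B' + u'(2A₁)`
implies `B ~ B'`. [folklore] -/
theorem W1Equiv.of_add_smul {B B' : Matrix (Fin 3) (Fin 3) ℤ} {u u' : ℤ}
    (h : W1Equiv (B + u • twoA1) (B' + u' • twoA1)) : W1Equiv B B' := by
  obtain ⟨σ, hσ, w, hw⟩ := h
  refine ⟨σ, hσ, u + w - u', ?_⟩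
  rw [Matrix.mul_add, Matrix.add_mul, Matrix.mul_smul, Matrix.smul_mul, hσ.2] at hw
  have hw' : B' = σ * B * σᵀ + u • twoA1 + w • twoA1 - u' • twoA1 := by
    rw [← hw]; abel
  rw [hw']
  module

/-- `ρ(γ) B ρ(γ)ᵀ = (det γ)² R(γ) B R(γ)ᵀ`. [folklore] -/
theorem rho_mul_mul_transpose (γ : Matrix (Fin 2) (Fin 2) ℤ) (B : Matrix (Fin 3) (Fin 3) ℤ) :
    rho γ * B * (rho γ)ᵀ = (γ.det ^ 2) • (symSq γ * B * (symSq γ)ᵀ) := by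
  rw [rho, Matrix.transpose_smul, Matrix.smul_mul, Matrix.smul_mul, Matrix.mul_smul, smul_smul,
    sq]

end TernaryPairs

namespace BinaryQuartic

open TernaryPairs

/-! ### Theorem 3.7 (Thm 2.14 of the published version): `φ` induces a bijection
`PGL₂(ℤ)\V_ℤ ≃ (F_{ℤ,1} × SO(A₁, ℤ))\W_{ℤ,1}` -/

/-- `φ(f) ∈ W_{ℤ,1}`: `2B_f` is a doubled integral Gram matrix. [folklore] -/
theorem isEvenSymm_gram (f : BinaryQuartic ℤ) : IsEvenSymm (gram f) := by
  refine ⟨Matrix.IsSymm.ext fun i j ↦ ?_, fun i ↦ ?_⟩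
  · fin_cases i <;> fin_cases j <;> rfl
  · fin_cases i <;> simp [gram]

/-- **Unique normal form in an `F_{ℤ,1}`-class**: `φ(f) + u A₁ = φ(f') + u' A₁` forces `f = f'`
and `u = u'` ("every `F_{ℤ,1}`-equivalence class of `W_{ℤ,1}` contains a unique element
`(A₁, B)` such that the top right entry of `B` is equal to `0`", Bhargava–Shankar, held arXiv
text §3.3 p. 16). [cite: BhargavaShankarAnnals2015, §3.3 p. 16 (unique representative with top right entry 0; arXiv:1006.1002v2 numbering)] -/
theorem gram_add_smul_inj {f f' : BinaryQuartic ℤ} {u u' : ℤ}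
    (h : gram f + u • (twoA1 : Matrix (Fin 3) (Fin 3) ℤ) = gram f' + u' • twoA1) :
    f = f' ∧ u = u' := by
  have e := fun i j ↦ congr_fun (congr_fun h i) j
  have h00 := e 0 0
  have h01 := e 0 1
  have h02 := e 0 2
  have h11 := e 1 1
  have h12 := e 1 2
  have h22 := e 2 2
  simp [gram, twoA1] at h00 h01 h02 h11 h12 h22
  exact ⟨BinaryQuartic.ext (by linarith) (by linarith) (by linarith) (by linarith) (by linarith),
    by linarith⟩

/-- **Every element of `W_{ℤ,1}` is `F_{ℤ,1}`-equivalent to some `φ(f)`**: a doubled integral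
Gram matrix `B` is `2B_f + u (2A₁)` with `u` = the top right entry of `B` (Bhargava–Shankar,
held arXiv text §3.3 p. 16: "`φ` maps `V_ℤ` bijectively to the set of `F_{ℤ,1}`-orbits on
`W_{ℤ,1}`"; published §2.6). [cite: BhargavaShankarAnnals2015, §3.3 p. 16 (V_ℤ → F_{ℤ,1}\W_{ℤ,1} bijective; arXiv:1006.1002v2 numbering)] -/
theorem exists_eq_gram_add_smul {B : Matrix (Fin 3) (Fin 3) ℤ} (hB : IsEvenSymm B) :
    ∃ f : BinaryQuartic ℤ, B = gram f + B 0 2 • twoA1 := by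
  obtain ⟨k₀, hk₀⟩ := hB.2 0
  obtain ⟨k₁, hk₁⟩ := hB.2 1
  obtain ⟨k₂, hk₂⟩ := hB.2 2
  refine ⟨⟨k₀, B 0 1, k₁ + B 0 2, B 1 2, k₂⟩, ?_⟩
  have s01 := hB.1.apply 0 1
  have s02 := hB.1.apply 0 2
  have s12 := hB.1.apply 1 2
  ext i j
  fin_cases i <;> fin_cases j <;> simp [gram, twoA1] <;> linarith

/-- The inverse normal form map `W_{ℤ,1} → V_ℤ`: `B ↦ f` with `B = 2B_f + B₀₂ (2A₁)`
(meaningful on doubled integral Gram matrices). [folklore] -/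
def ofEvenSymm (B : Matrix (Fin 3) (Fin 3) ℤ) : BinaryQuartic ℤ :=
  ⟨B 0 0 / 2, B 0 1, B 1 1 / 2 + B 0 2, B 1 2, B 2 2 / 2⟩

/-- `B = 2B_{f(B)} + B₀₂ (2A₁)` for `B ∈ W_{ℤ,1}`. [folklore] -/
theorem gram_ofEvenSymm_add {B : Matrix (Fin 3) (Fin 3) ℤ} (hB : IsEvenSymm B) :
    gram (ofEvenSymm B) + B 0 2 • twoA1 = B := by
  obtain ⟨f, hf⟩ := exists_eq_gram_add_smul hB
  have hf' : ofEvenSymm B = f := by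
    have e := fun i j ↦ congr_fun (congr_fun hf i) j
    have h00 := e 0 0
    have h01 := e 0 1
    have h11 := e 1 1
    have h12 := e 1 2
    have h22 := e 2 2
    simp [gram, twoA1] at h00 h01 h11 h12 h22
    refine BinaryQuartic.ext ?_ ?_ ?_ ?_ ?_ <;> simp only [ofEvenSymm]
    · rw [h00]; simp
    · rw [h01]
    · rw [h11]; omega
    · rw [h12]
    · rw [h22]; simp
  rw [hf', ← hf]

/-- `f(2B_f) = f`. [folklore] -/
@[simp] theorem ofEvenSymm_gram (f : BinaryQuartic ℤ) : ofEvenSymm (gram f) = f := by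
  ext <;> simp [ofEvenSymm, gram]

/-- `φ(γ · f) ~ φ(f)` for `γ ∈ GL₂(ℤ)`: `2B_{γ·f} = ρ(γ) (2B_f) ρ(γ)ᵀ + u (2A₁)` with
`ρ(γ) ∈ SO(A₁, ℤ)` (equivariance of `φ`, Bhargava–Shankar, held arXiv text §3.3 p. 16).
[cite: BhargavaShankarAnnals2015, §3.3 p. 16 (equivariance of φ; arXiv:1006.1002v2 numbering)] -/
theorem w1Equiv_gram_subst (f : BinaryQuartic ℤ) {γ : Matrix (Fin 2) (Fin 2) ℤ}
    (hγ : IsUnit γ.det) : W1Equiv (gram f) (gram (f.subst γ)) := by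
  have h2 : γ.det ^ 2 = 1 := by rcases Int.isUnit_iff.mp hγ with h | h <;> rw [h] <;> norm_num
  refine ⟨rho γ, rho_mem_soA1 hγ, gramShift f γ, ?_⟩
  rw [rho_mul_mul_transpose, h2, one_smul, gram_subst]

/-- **Injectivity in Theorem 3.7**: if `φ(f')` is `F_{ℤ,1} × SO(A₁, ℤ)`-equivalent to `φ(f)` then
`f' = γ · f` for some `γ ∈ GL₂(ℤ)` — via `SO(A₁, ℤ) = ρ(PGL₂(ℤ))` and the unique normal form.
[cite: BhargavaShankarAnnals2015, Thm 3.7 (arXiv:1006.1002v2 numbering; Thm 2.14 of the published version)] -/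
theorem gl2zEquiv_of_w1Equiv_gram {f f' : BinaryQuartic ℤ} (h : W1Equiv (gram f) (gram f')) :
    GL2ZEquiv f f' := by
  obtain ⟨σ, hσ, u, hu⟩ := h
  obtain ⟨γ, hγ, rfl⟩ := exists_rho_eq_of_mem_soA1 hσ
  have h2 : γ.det ^ 2 = 1 := by rcases Int.isUnit_iff.mp hγ with h | h <;> rw [h] <;> norm_num
  rw [rho_mul_mul_transpose, h2, one_smul] at hu
  have key : gram f' + gramShift f γ • (twoA1 : Matrix (Fin 3) (Fin 3) ℤ) =
      gram (f.subst γ) + u • twoA1 := by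
    rw [hu, gram_subst, add_right_comm]
  obtain ⟨rfl, -⟩ := gram_add_smul_inj key
  exact ⟨γ, hγ, rfl⟩

/-- **Theorem 3.7 (held arXiv text) = Theorem 2.14 (published), class level**: `φ(f) ~ φ(f')`
under `F_{ℤ,1} × SO(A₁, ℤ)` iff `f ~ f'` under `GL₂(ℤ)` (equivalently `PGL₂(ℤ)`, as `−1` acts
trivially on `V_ℤ`). [cite: BhargavaShankarAnnals2015, Thm 3.7 (arXiv:1006.1002v2 numbering; Thm 2.14 of the published version)] -/
theorem w1Equiv_gram_iff (f f' : BinaryQuartic ℤ) :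
    W1Equiv (gram f) (gram f') ↔ GL2ZEquiv f f' :=
  ⟨gl2zEquiv_of_w1Equiv_gram, fun ⟨_, hγ, h⟩ ↦ h ▸ w1Equiv_gram_subst f hγ⟩

/-- `GL₂(ℤ)`-equivalence of integral binary quartic forms as a setoid (`PGL₂(ℤ)\V_ℤ`).
[folklore] -/
def gl2zSetoid : Setoid (BinaryQuartic ℤ) := ⟨GL2ZEquiv, GL2ZEquiv.equivalence⟩

/-- `W_{ℤ,1}` (doubled): the doubled integral Gram matrices `2B`, standing for the pairs
`(A₁, B) ∈ W_ℤ`. [cite: BhargavaShankarAnnals2015, §3.3 p. 16 (the set W_{ℤ,1}; arXiv:1006.1002v2 numbering)] -/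
def W1 : Type := {B : Matrix (Fin 3) (Fin 3) ℤ // IsEvenSymm B}

/-- `F_{ℤ,1} × SO(A₁, ℤ)`-equivalence on `W_{ℤ,1}` as a setoid. [folklore] -/
def w1Setoid : Setoid W1 :=
  ⟨fun B B' ↦ W1Equiv B.1 B'.1, ⟨fun B ↦ W1Equiv.refl B.1, W1Equiv.symm, W1Equiv.trans⟩⟩

/-- The class map `[f] ↦ [φ(f)]`. [cite: BhargavaShankarAnnals2015, Thm 3.7 (arXiv:1006.1002v2 numbering; Thm 2.14 of the published version)] -/
def phiClass : Quotient gl2zSetoid → Quotient w1Setoid :=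
  Quotient.lift (fun f ↦ (⟦⟨gram f, isEvenSymm_gram f⟩⟧ : Quotient w1Setoid))
    fun f f' h ↦ Quotient.sound ((w1Equiv_gram_iff f f').mpr h)

/-- The inverse class map `[B] ↦ [f]`, `B = 2B_f + u(2A₁)`. [folklore] -/
def phiClassInv : Quotient w1Setoid → Quotient gl2zSetoid :=
  Quotient.lift (fun B ↦ (⟦ofEvenSymm B.1⟧ : Quotient gl2zSetoid)) fun B B' h ↦ by
    apply Quotient.sound
    have hB := gram_ofEvenSymm_add B.2
    have hB' := gram_ofEvenSymm_add B'.2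
    have h' : W1Equiv (gram (ofEvenSymm B.1) + B.1 0 2 • twoA1)
        (gram (ofEvenSymm B'.1) + B'.1 0 2 • twoA1) := by
      rw [hB, hB']; exact h
    exact gl2zEquiv_of_w1Equiv_gram (W1Equiv.of_add_smul h')

/-- `phiClass [f] = [φ(f)]` (definitional). [folklore] -/
theorem phiClass_mk (f : BinaryQuartic ℤ) :
    phiClass ⟦f⟧ = (⟦⟨gram f, isEvenSymm_gram f⟩⟧ : Quotient w1Setoid) := rfl

/-- **Theorem 3.7 of Bhargava–Shankar (held arXiv text `arXiv:1006.1002v2`, p. 16) = Theorem 2.14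
of the published version (Ann. of Math. 181 (2015), §2.6)**, for `R = ℤ`: *"The map `φ` defined by
(26) gives a canonical bijection between `PGL₂(ℤ)`-orbits on `V_ℤ` and
`F_{ℤ,1} × SO(A₁, ℤ)`-orbits on `W_{ℤ,1}`."* Here `V_ℤ = BinaryQuartic ℤ` with `GL₂(ℤ)`-equivalence
(`= PGL₂(ℤ)`-equivalence, `−1` acting trivially), `W_{ℤ,1}` is realised as doubled integral Gram
matrices `2B` (`W1`), `φ(f) = 2B_f` (`gram`), and the `F_{ℤ,1} × SO(A₁, ℤ)`-classes are those of
`W1Equiv`. The proof combines the equivariance `gram_subst`, the unique normal form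
`gram_add_smul_inj` / `exists_eq_gram_add_smul`, and `SO(A₁, ℤ) = ρ(PGL₂(ℤ))`
(`exists_rho_eq_of_mem_soA1`, the analogue of [MWt, Lemma 4.4.2]).
[cite: BhargavaShankarAnnals2015, Thm 3.7 (arXiv:1006.1002v2 numbering; Thm 2.14 of the published version)] -/
def phiClassEquiv : Quotient gl2zSetoid ≃ Quotient w1Setoid where
  toFun := phiClass
  invFun := phiClassInv
  left_inv q := Quotient.inductionOn q fun f ↦ by
    simp [phiClass, phiClassInv]
  right_inv q := Quotient.inductionOn q fun B ↦ by
    simp only [phiClass, phiClassInv, Quotient.lift_mk]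
    apply Quotient.sound
    show W1Equiv (gram (ofEvenSymm B.1)) B.1
    refine ⟨1, one_mem_soA1, B.1 0 2, ?_⟩
    rw [Matrix.one_mul, Matrix.transpose_one, Matrix.mul_one, gram_ofEvenSymm_add B.2]

end BinaryQuartic

end Literature.NumberTheory.EllipticCurves
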